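import Literature.MathematicalPhysics.QuantumFieldTheory.ConformalBootstrap3D.PointKernelK34Data

/-!
# K34 certificate, kernel block file H6: head segments `150 ≤ i < 165` of `hsegs`, one theorem per segment (cells checked corner or chord by the rule bit)

`decide` by kernel reduction (no `native_decide`, no extra axioms) of the block checker of
`PointKernel` on the literal data of `PointKernelK34Data`; soundness is `PCert.hBlockOK_sound`.
Estimated kernel time 18 s (15 theorems).
-/

set_option maxRecDepth 100000
set_option maxHeartbeats 0

namespace Literature.MathematicalPhysics.QuantumFieldTheory.ConformalBootstrap3D.PointKernelK34

open Literature.MathematicalPhysics.QuantumFieldTheory.ConformalBootstrap3D.PointKernel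

/-- head segment `[150, 151)` passes the kernel evaluator. [folklore] -/
theorem hBlock_150 : cert.hBlockOK hsegs 150 151 JH = true := by
  decide +kernel

/-- head segment `[151, 152)` passes the kernel evaluator. [folklore] -/
theorem hBlock_151 : cert.hBlockOK hsegs 151 152 JH = true := by
  decide +kernel

/-- head segment `[152, 153)` passes the kernel evaluator. [folklore] -/
theorem hBlock_152 : cert.hBlockOK hsegs 152 153 JH = true := by
  decide +kernel

/-- head segment `[153, 154)` passes the kernel evaluator. [folklore] -/
theorem hBlock_153 : cert.hBlockOK hsegs 153 154 JH = true := by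
  decide +kernel

/-- head segment `[154, 155)` passes the kernel evaluator. [folklore] -/
theorem hBlock_154 : cert.hBlockOK hsegs 154 155 JH = true := by
  decide +kernel

/-- head segment `[155, 156)` passes the kernel evaluator. [folklore] -/
theorem hBlock_155 : cert.hBlockOK hsegs 155 156 JH = true := by
  decide +kernel

/-- head segment `[156, 157)` passes the kernel evaluator. [folklore] -/
theorem hBlock_156 : cert.hBlockOK hsegs 156 157 JH = true := by
  decide +kernel

/-- head segment `[157, 158)` passes the kernel evaluator. [folklore] -/
theorem hBlock_157 : cert.hBlockOK hsegs 157 158 JH = true := by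
  decide +kernel

/-- head segment `[158, 159)` passes the kernel evaluator. [folklore] -/
theorem hBlock_158 : cert.hBlockOK hsegs 158 159 JH = true := by
  decide +kernel

/-- head segment `[159, 160)` passes the kernel evaluator. [folklore] -/
theorem hBlock_159 : cert.hBlockOK hsegs 159 160 JH = true := by
  decide +kernel

/-- head segment `[160, 161)` passes the kernel evaluator. [folklore] -/
theorem hBlock_160 : cert.hBlockOK hsegs 160 161 JH = true := by
  decide +kernel

/-- head segment `[161, 162)` passes the kernel evaluator. [folklore] -/
theorem hBlock_161 : cert.hBlockOK hsegs 161 162 JH = true := by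
  decide +kernel

/-- head segment `[162, 163)` passes the kernel evaluator. [folklore] -/
theorem hBlock_162 : cert.hBlockOK hsegs 162 163 JH = true := by
  decide +kernel

/-- head segment `[163, 164)` passes the kernel evaluator. [folklore] -/
theorem hBlock_163 : cert.hBlockOK hsegs 163 164 JH = true := by
  decide +kernel

/-- head segment `[164, 165)` passes the kernel evaluator. [folklore] -/
theorem hBlock_164 : cert.hBlockOK hsegs 164 165 JH = true := by
  decide +kernel

end Literature.MathematicalPhysics.QuantumFieldTheory.ConformalBootstrap3D.PointKernelK34
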